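import Literature.AnabelianGeometry.EtaleTheta.BiKummerThm44SubRoots

/-!
# [EtTh] §4: `N`-th roots of fraction-pairs TRANSPORTED along `Ψ` and RE-ANCHORED — the infrastructure of
# Remark 4.3.2 / Theorem 4.4 (ii) / Corollary 5.12 ("`Ψ` maps root diagrams to root diagrams")

S. Mochizuki, *The étale theta function and its Frobenioid-theoretic manifestations*, Publ. RIMS **45** (2009)
[cite: MochizukiEtTh2009, Prop 4.2 (iii)(iv) p.314–315 (PDF pp.88–89); Rmk 4.3.2 p.318–319 (PDF pp.92–93);
Thm 4.4 (ii) p.320 (PDF p.94); Cor 5.12 p.339 (PDF p.113)].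

abc-iut cell, layer L2, row R192 of `plan/L2/ASSIGNMENTS.md` (B′ «`NthRoot` TRANSPORT ALONG `Ψ`» infrastructure
of abc-iut-L2-d4's `staging/L2/L2-d4/SHAPES-Thm57-residual-B.md` §1), seat abc-iut-f-121.  Built ON abc-iut-L2-t3's
§4 vocabulary (`BiKummer.lean`, `BiKummerRoots.lean`: `FractionPair`, `BaseFrobeniusTypeData`, `NthRoot`) and the
Theorem 4.4 sub-node currency of `BiKummerThm44Sub*.lean` (`Thm44Hyp`, `Thm44_ii`, T44-L03/L04b/L08/L15a/L15(⇒),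
`preservesNthRoots_of`); nothing landed is edited.

WHAT PRINT SAYS.  Thm 4.4 (ii), last clause (p.320 (PDF p.94)): "`Ψ` maps `N`-th roots of fraction-pairs … to
`N`-th roots of fraction-pairs"; Rmk 4.3.2 (p.318–319 (PDF pp.92–93)): roots at varying `N` form "a compatible
system of roots"; the proof of Thm 5.7 (p.330 (PDF p.104)) and the setting of Cor 5.12 (p.339 (PDF p.113)) use
that `Ψ` carries the root DIAGRAMS `A_N —s′_N, s″_N→ B_N` over `A —s′, s″→ B` (via `α : A_N → A`, `β : B_N → B`)
to root diagrams, which — once `Ψ(A)`, `Ψ(B)` are IDENTIFIED with given objects (the "anchor") — are again root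
diagrams over the re-anchored base pair.  abc-iut-L2-t3's `Thm44Hyp.PreservesNthRoots` states the image-root
clause in `∃`-form, for domains `≅ A_⊙`, and WITHOUT re-anchoring; the consumers of the §5 tower (abc-iut-L2-d4's
all-levels Thm 5.7, `Discharge/Sec5Thm57ChosenFamily.lean`) need the image root as a DEFINITE object whose fields
are the `Ψ`-images ON THE NOSE and whose structural maps are re-anchored at chosen identifications.

WHAT THIS FILE GIVES (one construction, in three steps, + field lemmas):
* `BaseFrobeniusTypeData.compIso` — the Def 4.1 (iv) data of `α` re-anchored along an isomorphism of the
  codomain (`α ↦ α ≫ e`; `G`, `α″` kept, `α′ ↦ α′ ≫ e`); clauses (a)–(d) PROVED from [FrdI] Rem 1.1.1/1.2.1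
  (`degFr_comp`, `degFr_iso_hom`, `IsPullbackMorphism.comp`, `isPullbackMorphism_of_isIso`, `galOver_comp_iso`);
  clause (e) "arise from a base-Frobenius pair" is an ABSTRACT field of the setting, so its stability under
  isomorphisms of the codomain is the ONE named binder `hArises` ([FrdI] Def 2.7 (iii) data are insensitive to
  re-anchoring the codomain by an isomorphism — true in print, not derivable from a law-free field).
* `NthRoot.reanchor` (Ψ-FREE): a root of `(f, P)` on `(A, B)` and anchors `eA : A ≅ A₂`, `eB : B ≅ B₂` onto a
  target pair `P₂` of `f₂` on `(A₂, B₂)` (`eA⁻¹ ≫ s′ ≫ eB = s′₂`, `eA⁻¹ ≫ s″ ≫ eB = s″₂`, `(eA)^* f₂ = f`) give a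
  root of `(f₂, P₂)` with the SAME `A_N, B_N, f_N, (s′_N, s″_N)` and `α ↦ α ≫ eA`, `β ↦ β ≫ eB`.
* `NthRoot.map` (for abc-iut-L2-t3's `h : Thm44Hyp S₁ S₂`): the `Ψ`-image root of the `Ψ`-image pair — the DEF
  form of `Thm44Hyp.preservesNthRoots_of` (same named inputs, no "domain `≅ A_⊙`" binder, which that proof never
  used): `A_N ↦ Ψ A_N`, `B_N ↦ Ψ B_N`, `α ↦ Ψ α`, `β ↦ Ψ β`, `f_N ↦ ψ f_N`, `(s′_N, s″_N) ↦ (Ψ s′_N, Ψ s″_N)`.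
* `NthRoot.transport := (R.map …).reanchor eA eB` — "`Ψ` of a root diagram is a root diagram of the transported
  pair, re-anchored at `(eA, eB)`" (SHAPES §1's missing `NthRoot.transport (Ψ) (identifications at the anchor)`);
  in the self-equivalence case `S₁ = S₂ = S` (abc-iut-L2-t9's `Sec5Prop51Thm44Pin`: `∃ hh : Thm44Hyp S S, hh.Ψ = Ψ`)
  with anchors FIXING the pair (`P₂ = P`) it is an `N`-th root of the SAME pair, ready for Prop 4.2 (iv)
  (`Prop42_iv`, BY NAME; sequel `Discharge/Sec4RootTransportUniqueness.lean`).
HONEST FRAMING: definitions and kernel-checked field identities over abc-iut-L2-t3's law-free §4 interface; every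
[FrdI]/[EtTh] input is a NAMED binder in the currency of `BiKummerThm44Sub*.lean`; refereed pre-IUT material;
nothing here bears on [IUTchIII] Cor. 3.12 or takes a side; typed ≠ proved for any genuine datum.
-/

noncomputable section

namespace Literature.AnabelianGeometry.EtaleTheta

open CategoryTheory Opposite Literature.AlgebraicGeometry.Frobenioids

namespace BiKummerSetting

universe u₀ v₀ u v w

variable {K : Type u₀} [Field K] {K' : Type u₀} [Field K'] {D₀ : Type u₀} [Category.{v₀} D₀]
  {V : FrdIMonoidStub.{w}}
  {X₁ : SemiGraphs.TemperedArithmeticGroup.{u₀} K} {X₂ : SemiGraphs.TemperedArithmeticGroup.{u₀} K'}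
  {D₀' : Type u₀} [Category.{v₀} D₀']
  {T₁ : RealifiedDivisorMonoids (D₀ := D₀) V} {T₂ : RealifiedDivisorMonoids (D₀ := D₀') V}
  {D₁ D₂ : Type u} [Category.{v} D₁] [Category.{v} D₂] {VD₁ : FrdICatStub.{u, v, w} D₁}
  {VD₂ : FrdICatStub.{u, v, w} D₂} {S₁ : BiKummerSetting X₁ T₁ D₁ VD₁} {S₂ : BiKummerSetting X₂ T₂ D₂ VD₂}
  {S : BiKummerSetting X₁ T₁ D₁ VD₁}

/-! ### §1. [FrdI] Rem 1.1.1 / 1.2.1 bookkeeping: composing with an isomorphism of the codomain -/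

/-- `deg_Fr(α ≫ e) = deg_Fr(α)` for an isomorphism `e` (Rem 1.1.1). [cite: MochizukiEtTh2009, Def 4.1 p.313 (PDF p.87)] -/
theorem degFr_comp_iso {A B B' : S.C} (α : A ⟶ B) (e : B ≅ B') : S.degFr (α ≫ e.hom) = S.degFr α := by
  show PreFrobenioid.degFr S.F (α ≫ e.hom) = PreFrobenioid.degFr S.F α
  rw [PreFrobenioid.degFr_comp, show PreFrobenioid.degFr S.F e.hom = 1 from PreFrobenioid.isLinear_of_isIso S.F e.hom,
    mul_one]

/-- An isometry followed by an isometric isomorphism is an isometry (Rem 1.1.1). [cite: MochizukiEtTh2009, Prop 4.2 p.314 (PDF p.88)] -/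
theorem isIsometry_comp_iso {A B B' : S.C} {α : A ⟶ B} (hα : S.IsIsometry α) (e : B ≅ B')
    (he : S.IsIsometry e.hom) : S.IsIsometry (α ≫ e.hom) :=
  PreFrobenioid.IsIsometry.comp S.F hα he

/-- A pull-back morphism followed by an isomorphism is a pull-back morphism (Rem 1.2.1).
[cite: MochizukiEtTh2009, Def 4.1 p.313 (PDF p.87)] -/
theorem isPullback_comp_iso {A B B' : S.C} {α : A ⟶ B} (hα : S.IsPullback α) (e : B ≅ B') :
    S.IsPullback (α ≫ e.hom) :=
  PreFrobenioid.IsPullbackMorphism.comp S.F hα (PreFrobenioid.isPullbackMorphism_of_isIso S.F e.hom)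

/-- `Base(e)` of an isomorphism `e` of `C` is an isomorphism of `D`. [cite: MochizukiEtTh2009, Def 4.1 p.313 (PDF p.87)] -/
theorem isIso_baseMap_iso {B B' : S.C} (e : B ≅ B') : IsIso (ModelFrobenioid.baseMap e.hom) :=
  ⟨⟨ModelFrobenioid.baseMap e.inv,
    by rw [← ModelFrobenioid.baseMap_comp, e.hom_inv_id, ModelFrobenioid.baseMap_id],
    by rw [← ModelFrobenioid.baseMap_comp, e.inv_hom_id, ModelFrobenioid.baseMap_id]⟩⟩

/-- `Gal(A^bs/B^bs)` is unchanged by re-anchoring the codomain along an isomorphism: `Gal(α ≫ e) = Gal(α)`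
(Def 4.1 (iv)(b)). [cite: MochizukiEtTh2009, Def 4.1 p.313 (PDF p.87)] -/
theorem galOver_comp_iso {A B B' : S.C} (α : A ⟶ B) (e : B ≅ B') : S.galOver (α ≫ e.hom) = S.galOver α := by
  haveI := S.isIso_baseMap_iso e
  ext σ
  show σ.hom ≫ ModelFrobenioid.baseMap (α ≫ e.hom) = ModelFrobenioid.baseMap (α ≫ e.hom) ↔
    σ.hom ≫ ModelFrobenioid.baseMap α = ModelFrobenioid.baseMap α
  rw [ModelFrobenioid.baseMap_comp, ← Category.assoc, cancel_mono]

/-- `Aut_{C_B}(α) ≤ Aut_{C_{B′}}(α ≫ e)` (Def 4.1 (iv)). [cite: MochizukiEtTh2009, Def 4.1 p.313 (PDF p.87)] -/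
theorem autOver_le_comp_iso {A B B' : S.C} (α : A ⟶ B) (e : B ≅ B') : S.autOver α ≤ S.autOver (α ≫ e.hom) := by
  intro σ hσ
  have hσ' : σ.hom ≫ α = α := hσ
  show σ.hom ≫ α ≫ e.hom = α ≫ e.hom
  rw [← Category.assoc, hσ']

/-! ### §2. Definition 4.1 (iv) data re-anchored along an isomorphism of the codomain -/

namespace BaseFrobeniusTypeData

/-- **Def 4.1 (iv) data of `α : A → B` re-anchored at `e : B ≅ B′`**: the data `(G, α′ ≫ e, α″)` "of base-Frobenius
type" for `α ≫ e` — `N = deg_Fr` unchanged, `Gal(A^bs/B′^bs) = Gal(A^bs/B^bs)`, `α′ ≫ e` again a pull-back morphism;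
clause (e) transported by the named binder `hArises`. [cite: MochizukiEtTh2009, Def 4.1 p.313 (PDF p.87)] -/
def compIso {A B B' : S.C} {α : A ⟶ B} (d : S.BaseFrobeniusTypeData α) (e : B ≅ B')
    (hArises : S.ArisesFromBaseFrobeniusPair d.G d.α₂ (d.α₁ ≫ e.hom)) :
    S.BaseFrobeniusTypeData (α ≫ e.hom) where
  G := d.G
  G_le := d.G_le.trans (S.autOver_le_comp_iso α e)
  α₂ := d.α₂
  α₁ := d.α₁ ≫ e.hom
  fac := by rw [← Category.assoc, d.fac]
  isFrobeniusTrivial := d.isFrobeniusTrivial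
  isGalois := d.isGalois
  isMuSaturated := by rw [S.degFr_comp_iso α e]; exact d.isMuSaturated
  mapsIsomorphically := by rw [S.galOver_comp_iso α e]; exact d.mapsIsomorphically
  cond_c := d.cond_c
  cond_d := S.isPullback_comp_iso d.cond_d e
  cond_e := hArises

/-- The re-anchored `α′` is `α′ ≫ e`. [cite: MochizukiEtTh2009, Def 4.1 p.313 (PDF p.87)] -/
@[simp] theorem compIso_α₁ {A B B' : S.C} {α : A ⟶ B} (d : S.BaseFrobeniusTypeData α) (e : B ≅ B')
    (hArises : S.ArisesFromBaseFrobeniusPair d.G d.α₂ (d.α₁ ≫ e.hom)) :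
    (d.compIso e hArises).α₁ = d.α₁ ≫ e.hom := rfl

end BaseFrobeniusTypeData

/-! ### §3. `NthRoot.reanchor`: a root of `(f, P)` re-anchored along isomorphisms of the base pair (Ψ-free) -/

namespace NthRoot

/-- **Re-anchoring an `N`-th root along isomorphisms of the base pair** (Prop 4.2 (iii) data, p.314 (PDF p.88);
the bookkeeping behind Rmk 4.3.2 / Cor 5.12's "morphisms of root diagrams").  Given a root
`(A_N, B_N, α, β, f_N, (s′_N, s″_N))` of the fraction-pair `P = (s′, s″)` of `f` on `(A, B)`, anchors `eA : A ≅ A₂`,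
`eB : B ≅ B₂`, and a TARGET pair `P₂ = (s′₂, s″₂)` of `f₂` on `(A₂, B₂)` with `eA⁻¹ ≫ s′ ≫ eB = s′₂`,
`eA⁻¹ ≫ s″ ≫ eB = s″₂` and `((eA)^birat)^* f₂ = f` (`hf`), the SAME `(A_N, B_N, f_N, (s′_N, s″_N))` with
`α ≫ eA`, `β ≫ eB` is a root of `P₂`.  Binders: `heA`, `heB` (the anchors are isometries — automatic in a
pre-Frobenioid, `PreFrobenioid.isIsometry_of_isIso`), `hArises` (clause (e) of Def 4.1 (iv) along `eA`),
`hpull` (functoriality of `((−)^birat)^*`, [FrdI] Prop 1.11 (iv)). [cite: MochizukiEtTh2009, Prop 4.2 (iii) p.314 (PDF p.88)] -/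
def reanchor {A B A₂ B₂ : S.C} {f : S.biratUnits A} {P : S.FractionPair f B} {N : ℕ+}
    {pullFrac : ∀ {A A' : S.C} (_ : A' ⟶ A), S.biratUnits A → S.biratUnits A'}
    (R : S.NthRoot f P N pullFrac) (eA : A ≅ A₂) (eB : B ≅ B₂) {f₂ : S.biratUnits A₂} (P₂ : S.FractionPair f₂ B₂)
    (hnum : eA.inv ≫ P.num ≫ eB.hom = P₂.num) (hden : eA.inv ≫ P.den ≫ eB.hom = P₂.den)
    (hf : pullFrac eA.hom f₂ = f) (heA : S.IsIsometry eA.hom) (heB : S.IsIsometry eB.hom)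
    (hArises : S.ArisesFromBaseFrobeniusPair R.αData.G R.αData.α₂ (R.αData.α₁ ≫ eA.hom))
    (hpull : ∀ {X Y Z : S.C} (φ : X ⟶ Y) (ψ : Y ⟶ Z) (g : S.biratUnits Z),
      pullFrac (φ ≫ ψ) g = pullFrac φ (pullFrac ψ g)) :
    S.NthRoot f₂ P₂ N pullFrac where
  AN := R.AN
  BN := R.BN
  α := R.α ≫ eA.hom
  β := R.β ≫ eB.hom
  root := R.root
  pair := R.pair
  comm_num := by
    rw [← hnum, ← Category.assoc, R.comm_num, Category.assoc, Category.assoc, eA.hom_inv_id_assoc]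
  comm_den := by
    rw [← hden, ← Category.assoc, R.comm_den, Category.assoc, Category.assoc, eA.hom_inv_id_assoc]
  isIsometry := ⟨S.isIsometry_comp_iso R.isIsometry.1 eA heA, S.isIsometry_comp_iso R.isIsometry.2.1 eB heB,
    (S.degFr_comp_iso R.α eA).trans R.isIsometry.2.2.1, (S.degFr_comp_iso R.β eB).trans R.isIsometry.2.2.2⟩
  αData := R.αData.compIso eA hArises
  pow_root := by
    rw [BaseFrobeniusTypeData.compIso_α₁, hpull, hf]
    exact R.pow_root
  isSaturated := by
    rw [BaseFrobeniusTypeData.compIso_α₁, hpull, hf]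
    exact R.isSaturated

section reanchor_lemmas

variable {A B A₂ B₂ : S.C} {f : S.biratUnits A} {P : S.FractionPair f B} {N : ℕ+}
    {pullFrac : ∀ {A A' : S.C} (_ : A' ⟶ A), S.biratUnits A → S.biratUnits A'}
    (R : S.NthRoot f P N pullFrac) (eA : A ≅ A₂) (eB : B ≅ B₂) {f₂ : S.biratUnits A₂} (P₂ : S.FractionPair f₂ B₂)
    (hnum : eA.inv ≫ P.num ≫ eB.hom = P₂.num) (hden : eA.inv ≫ P.den ≫ eB.hom = P₂.den)
    (hf : pullFrac eA.hom f₂ = f) (heA : S.IsIsometry eA.hom) (heB : S.IsIsometry eB.hom)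
    (hArises : S.ArisesFromBaseFrobeniusPair R.αData.G R.αData.α₂ (R.αData.α₁ ≫ eA.hom))
    (hpull : ∀ {X Y Z : S.C} (φ : X ⟶ Y) (ψ : Y ⟶ Z) (g : S.biratUnits Z),
      pullFrac (φ ≫ ψ) g = pullFrac φ (pullFrac ψ g))

/-- The re-anchored `α` is `α ≫ eA`. [cite: MochizukiEtTh2009, Prop 4.2 (iii) p.314 (PDF p.88)] -/
@[simp] theorem reanchor_α : (R.reanchor eA eB P₂ hnum hden hf heA heB hArises hpull).α = R.α ≫ eA.hom := rfl

/-- The re-anchored `β` is `β ≫ eB`. [cite: MochizukiEtTh2009, Prop 4.2 (iii) p.314 (PDF p.88)] -/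
@[simp] theorem reanchor_β : (R.reanchor eA eB P₂ hnum hden hf heA heB hArises hpull).β = R.β ≫ eB.hom := rfl

/-- The re-anchored `α′` is `α′ ≫ eA` (so `f|_{A_N}` is unchanged, by `hf`). [cite: MochizukiEtTh2009, Prop 4.2 (iii) p.314 (PDF p.88)] -/
@[simp] theorem reanchor_αData_α₁ :
    (R.reanchor eA eB P₂ hnum hden hf heA heB hArises hpull).αData.α₁ = R.αData.α₁ ≫ eA.hom := rfl

end reanchor_lemmas

end NthRoot

/-! ### §4. `NthRoot.map`: the `Ψ`-image root of the `Ψ`-image pair (Thm 4.4 (ii), last clause — DEF form) -/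

namespace NthRoot

/-- **The `Ψ`-image of an `N`-th root** (Thm 4.4 (ii), last clause, p.320 (PDF p.94); proof p.321 (PDF p.95)
ll.12–16): for abc-iut-L2-t3's `h : Thm44Hyp S₁ S₂` with `Ψ^birat`-identifications `ψ` compatible with the
pull-backs (`hpull`), "`Ψ` preserves fraction-pairs" (`Thm44_ii`, T44-L13), T44-L03 (isometries, `deg_Fr`), T44-L04b
(Def 4.1 (iv) data), T44-L08 (ampleness), T44-L15a (fixedness), T44-L15 (⇒) (saturation), the image
`(Ψ A_N, Ψ B_N, Ψ α, Ψ β, ψ f_N, (Ψ s′_N, Ψ s″_N))` is an `N`-th root of the image pair `Q = (Ψ s′, Ψ s″)` of `ψ f` on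
`(Ψ A, Ψ B)`.  The definite form of abc-iut-L2-t3's `Thm44Hyp.preservesNthRoots_of` (which proves the `∃`-form
`PreservesNthRoots`); the image pair of the root and the transported Def 4.1 (iv) data are CHOSEN from `Thm44_ii` /
T44-L04b. [cite: MochizukiEtTh2009, Thm 4.4 (ii) p.320 (PDF p.94)] -/
def map (h : Thm44Hyp S₁ S₂) (ψ : ∀ A : S₁.C, S₁.biratUnits A ≃* S₂.biratUnits (h.Ψ.functor.obj A))
    {pullFrac₁ : ∀ {A A' : S₁.C} (_ : A' ⟶ A), S₁.biratUnits A → S₁.biratUnits A'}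
    (pullFrac₂ : ∀ {A A' : S₂.C} (_ : A' ⟶ A), S₂.biratUnits A → S₂.biratUnits A')
    (hpull : ∀ {A A' : S₁.C} (φ : A' ⟶ A) (f : S₁.biratUnits A),
      ψ A' (pullFrac₁ φ f) = pullFrac₂ (h.Ψ.functor.map φ) (ψ A f))
    (hii : Thm44_ii h ψ) (h3 : h.PreservesFrobeniusStructure) (h4b : h.PreservesBaseFrobeniusTypeData)
    (h8 : h.PreservesAmple) (h15a : h.PreservesFixedByHA ψ) (h15 : h.PreservesSaturated ψ)
    {A B : S₁.C} {f : S₁.biratUnits A} {P : S₁.FractionPair f B} {N : ℕ+} (R : S₁.NthRoot f P N pullFrac₁)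
    (Q : S₂.FractionPair (ψ A f) (h.Ψ.functor.obj B))
    (hQn : Q.num = h.Ψ.functor.map P.num) (hQd : Q.den = h.Ψ.functor.map P.den) :
    S₂.NthRoot (ψ A f) Q N pullFrac₂ where
  AN := h.Ψ.functor.obj R.AN
  BN := h.Ψ.functor.obj R.BN
  α := h.Ψ.functor.map R.α
  β := h.Ψ.functor.map R.β
  root := ψ R.AN R.root
  pair := Classical.choose (hii R.root R.pair)
  comm_num := by
    rw [(Classical.choose_spec (hii R.root R.pair)).1, hQn, ← Functor.map_comp, ← Functor.map_comp, R.comm_num]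
  comm_den := by
    rw [(Classical.choose_spec (hii R.root R.pair)).2, hQd, ← Functor.map_comp, ← Functor.map_comp, R.comm_den]
  isIsometry := ⟨h3.2.1 _ R.isIsometry.1, h3.2.1 _ R.isIsometry.2.1,
    (h3.1 _).trans R.isIsometry.2.2.1, (h3.1 _).trans R.isIsometry.2.2.2⟩
  αData := Classical.choose (h4b R.α R.αData)
  pow_root := by
    rw [(Classical.choose_spec (h4b R.α R.αData)).2.2, ← map_pow, R.pow_root, hpull]
  isSaturated := by
    have hAmp : S₂.IsAmple (h.Ψ.functor.obj R.AN) := h8 _ R.isSaturated.isAmple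
    have hfix : S₂.IsFixedByHA (h.Ψ.functor.obj R.AN) hAmp.isGalois (ψ R.AN (pullFrac₁ R.αData.α₁ f)) :=
      h15a _ R.isSaturated.isAmple.isGalois hAmp.isGalois _ R.isSaturated.fixed
    rw [(Classical.choose_spec (h4b R.α R.αData)).2.2, ← hpull]
    exact h15 _ N _ hAmp hfix R.isSaturated

section map_lemmas

variable (h : Thm44Hyp S₁ S₂) (ψ : ∀ A : S₁.C, S₁.biratUnits A ≃* S₂.biratUnits (h.Ψ.functor.obj A))
    {pullFrac₁ : ∀ {A A' : S₁.C} (_ : A' ⟶ A), S₁.biratUnits A → S₁.biratUnits A'}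
    (pullFrac₂ : ∀ {A A' : S₂.C} (_ : A' ⟶ A), S₂.biratUnits A → S₂.biratUnits A')
    (hpull : ∀ {A A' : S₁.C} (φ : A' ⟶ A) (f : S₁.biratUnits A),
      ψ A' (pullFrac₁ φ f) = pullFrac₂ (h.Ψ.functor.map φ) (ψ A f))
    (hii : Thm44_ii h ψ) (h3 : h.PreservesFrobeniusStructure) (h4b : h.PreservesBaseFrobeniusTypeData)
    (h8 : h.PreservesAmple) (h15a : h.PreservesFixedByHA ψ) (h15 : h.PreservesSaturated ψ)
    {A B : S₁.C} {f : S₁.biratUnits A} {P : S₁.FractionPair f B} {N : ℕ+} (R : S₁.NthRoot f P N pullFrac₁)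
    (Q : S₂.FractionPair (ψ A f) (h.Ψ.functor.obj B))
    (hQn : Q.num = h.Ψ.functor.map P.num) (hQd : Q.den = h.Ψ.functor.map P.den)

/-- `α` of the image root: `Ψ α`. [cite: MochizukiEtTh2009, Thm 4.4 (ii) p.320 (PDF p.94)] -/
@[simp] theorem map_α : (R.map h ψ pullFrac₂ hpull hii h3 h4b h8 h15a h15 Q hQn hQd).α = h.Ψ.functor.map R.α := rfl

/-- `β` of the image root: `Ψ β`. [cite: MochizukiEtTh2009, Thm 4.4 (ii) p.320 (PDF p.94)] -/
@[simp] theorem map_β : (R.map h ψ pullFrac₂ hpull hii h3 h4b h8 h15a h15 Q hQn hQd).β = h.Ψ.functor.map R.β := rfl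

/-- `s′_N` of the image root: `Ψ s′_N`. [cite: MochizukiEtTh2009, Thm 4.4 (ii) p.320 (PDF p.94)] -/
theorem map_pair_num :
    (R.map h ψ pullFrac₂ hpull hii h3 h4b h8 h15a h15 Q hQn hQd).pair.num = h.Ψ.functor.map R.pair.num :=
  (Classical.choose_spec (hii R.root R.pair)).1

/-- `s″_N` of the image root: `Ψ s″_N`. [cite: MochizukiEtTh2009, Thm 4.4 (ii) p.320 (PDF p.94)] -/
theorem map_pair_den :
    (R.map h ψ pullFrac₂ hpull hii h3 h4b h8 h15a h15 Q hQn hQd).pair.den = h.Ψ.functor.map R.pair.den :=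
  (Classical.choose_spec (hii R.root R.pair)).2

/-- The Def 4.1 (iv) data of the image root: `G ↦ Ψ(G)`. [cite: MochizukiEtTh2009, Thm 4.4 (ii) p.320 (PDF p.94)] -/
theorem map_αData_G : (R.map h ψ pullFrac₂ hpull hii h3 h4b h8 h15a h15 Q hQn hQd).αData.G =
    R.αData.G.map (h.Ψ.functor.mapAut R.AN) :=
  (Classical.choose_spec (h4b R.α R.αData)).1

/-- The Def 4.1 (iv) data of the image root: `α″ ↦ Ψ α″`. [cite: MochizukiEtTh2009, Thm 4.4 (ii) p.320 (PDF p.94)] -/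
theorem map_αData_α₂ : (R.map h ψ pullFrac₂ hpull hii h3 h4b h8 h15a h15 Q hQn hQd).αData.α₂ =
    h.Ψ.functor.map R.αData.α₂ :=
  (Classical.choose_spec (h4b R.α R.αData)).2.1

/-- The Def 4.1 (iv) data of the image root: `α′ ↦ Ψ α′`. [cite: MochizukiEtTh2009, Thm 4.4 (ii) p.320 (PDF p.94)] -/
theorem map_αData_α₁ : (R.map h ψ pullFrac₂ hpull hii h3 h4b h8 h15a h15 Q hQn hQd).αData.α₁ =
    h.Ψ.functor.map R.αData.α₁ :=
  (Classical.choose_spec (h4b R.α R.αData)).2.2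

end map_lemmas

/-! ### §5. `NthRoot.transport`: the `Ψ`-image root RE-ANCHORED at chosen identifications (SHAPES §1) -/

section transport

variable (h : Thm44Hyp S₁ S₂) (ψ : ∀ A : S₁.C, S₁.biratUnits A ≃* S₂.biratUnits (h.Ψ.functor.obj A))
    {pullFrac₁ : ∀ {A A' : S₁.C} (_ : A' ⟶ A), S₁.biratUnits A → S₁.biratUnits A'}
    (pullFrac₂ : ∀ {A A' : S₂.C} (_ : A' ⟶ A), S₂.biratUnits A → S₂.biratUnits A')
    (hpull : ∀ {A A' : S₁.C} (φ : A' ⟶ A) (f : S₁.biratUnits A),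
      ψ A' (pullFrac₁ φ f) = pullFrac₂ (h.Ψ.functor.map φ) (ψ A f))
    (hii : Thm44_ii h ψ) (h3 : h.PreservesFrobeniusStructure) (h4b : h.PreservesBaseFrobeniusTypeData)
    (h8 : h.PreservesAmple) (h15a : h.PreservesFixedByHA ψ) (h15 : h.PreservesSaturated ψ)
    {A B : S₁.C} {f : S₁.biratUnits A} {P : S₁.FractionPair f B} {N : ℕ+} (R : S₁.NthRoot f P N pullFrac₁)
    {A₂ B₂ : S₂.C} (eA : h.Ψ.functor.obj A ≅ A₂) (eB : h.Ψ.functor.obj B ≅ B₂) {f₂ : S₂.biratUnits A₂}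
    (P₂ : S₂.FractionPair f₂ B₂)
    (hnum : eA.inv ≫ h.Ψ.functor.map P.num ≫ eB.hom = P₂.num) (hden : eA.inv ≫ h.Ψ.functor.map P.den ≫ eB.hom = P₂.den)
    (hf : pullFrac₂ eA.hom f₂ = ψ A f) (heA : S₂.IsIsometry eA.hom) (heB : S₂.IsIsometry eB.hom)
    (hArises : ∀ {X Y Y' : S₂.C} (G : Subgroup (Aut X)) (α₂ : X ⟶ X) (α₁ : X ⟶ Y) (e : Y ≅ Y'),
      S₂.ArisesFromBaseFrobeniusPair G α₂ α₁ → S₂.ArisesFromBaseFrobeniusPair G α₂ (α₁ ≫ e.hom))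
    (hpull₂ : ∀ {X Y Z : S₂.C} (φ : X ⟶ Y) (χ : Y ⟶ Z) (g : S₂.biratUnits Z),
      pullFrac₂ (φ ≫ χ) g = pullFrac₂ φ (pullFrac₂ χ g))

/-- **`Ψ` of a root diagram is a root diagram of the transported pair, RE-ANCHORED** (Rmk 4.3.2 p.318–319 (PDF
pp.92–93); Thm 4.4 (ii) p.320 (PDF p.94); the setting of Cor 5.12, p.339 (PDF p.113): "`Ψ` maps the transition
diagrams to transition diagrams").  For a root `R` of `(f, P)` on `(A, B)`, anchors `eA : Ψ A ≅ A₂`, `eB : Ψ B ≅ B₂`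
and a target pair `P₂` of `f₂` on `(A₂, B₂)` with `eA⁻¹ ≫ Ψ s′ ≫ eB = s′₂`, `eA⁻¹ ≫ Ψ s″ ≫ eB = s″₂`,
`((eA)^birat)^* f₂ = ψ f`: the root `(Ψ A_N, Ψ B_N, Ψ α ≫ eA, Ψ β ≫ eB, ψ f_N, (Ψ s′_N, Ψ s″_N))` of `(f₂, P₂)` —
`:= (R.map …).reanchor eA eB P₂ …` through the image pair `(Ψ s′, Ψ s″)` chosen from `Thm44_ii`.  Self-case
`S₁ = S₂`, `P₂ = P`: an `N`-th root of the SAME pair (input of `Prop42_iv`).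
[cite: MochizukiEtTh2009, Rmk 4.3.2 p.318–319 (PDF pp.92–93); Thm 4.4 (ii) p.320 (PDF p.94)] -/
def transport : S₂.NthRoot f₂ P₂ N pullFrac₂ :=
  (R.map h ψ pullFrac₂ hpull hii h3 h4b h8 h15a h15 (Classical.choose (hii f P)) (Classical.choose_spec (hii f P)).1
      (Classical.choose_spec (hii f P)).2).reanchor eA eB P₂
    (by rw [(Classical.choose_spec (hii f P)).1]; exact hnum) (by rw [(Classical.choose_spec (hii f P)).2]; exact hden)
    hf heA heB (hArises _ _ _ eA (Classical.choose (h4b R.α R.αData)).cond_e) hpull₂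

/-- `N`-domain of the transported root: `Ψ A_N`. [cite: MochizukiEtTh2009, Thm 4.4 (ii) p.320 (PDF p.94)] -/
@[simp] theorem transport_AN :
    (R.transport h ψ pullFrac₂ hpull hii h3 h4b h8 h15a h15 eA eB P₂ hnum hden hf heA heB hArises hpull₂).AN =
      h.Ψ.functor.obj R.AN := rfl

/-- `N`-codomain of the transported root: `Ψ B_N`. [cite: MochizukiEtTh2009, Thm 4.4 (ii) p.320 (PDF p.94)] -/
@[simp] theorem transport_BN :
    (R.transport h ψ pullFrac₂ hpull hii h3 h4b h8 h15a h15 eA eB P₂ hnum hden hf heA heB hArises hpull₂).BN =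
      h.Ψ.functor.obj R.BN := rfl

/-- `α` of the transported root: `Ψ α ≫ eA` (re-anchored at `A₂`). [cite: MochizukiEtTh2009, Rmk 4.3.2 p.319 (PDF p.93)] -/
@[simp] theorem transport_α :
    (R.transport h ψ pullFrac₂ hpull hii h3 h4b h8 h15a h15 eA eB P₂ hnum hden hf heA heB hArises hpull₂).α =
      h.Ψ.functor.map R.α ≫ eA.hom := rfl

/-- `β` of the transported root: `Ψ β ≫ eB` (re-anchored at `B₂`). [cite: MochizukiEtTh2009, Rmk 4.3.2 p.319 (PDF p.93)] -/
@[simp] theorem transport_β :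
    (R.transport h ψ pullFrac₂ hpull hii h3 h4b h8 h15a h15 eA eB P₂ hnum hden hf heA heB hArises hpull₂).β =
      h.Ψ.functor.map R.β ≫ eB.hom := rfl

/-- `f_N` of the transported root: `ψ f_N`. [cite: MochizukiEtTh2009, Thm 4.4 (ii) p.320 (PDF p.94)] -/
@[simp] theorem transport_root :
    (R.transport h ψ pullFrac₂ hpull hii h3 h4b h8 h15a h15 eA eB P₂ hnum hden hf heA heB hArises hpull₂).root =
      ψ R.AN R.root := rfl

/-- `s′_N` of the transported root: `Ψ s′_N`. [cite: MochizukiEtTh2009, Thm 4.4 (ii) p.320 (PDF p.94)] -/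
theorem transport_pair_num :
    (R.transport h ψ pullFrac₂ hpull hii h3 h4b h8 h15a h15 eA eB P₂ hnum hden hf heA heB hArises hpull₂).pair.num =
      h.Ψ.functor.map R.pair.num :=
  R.map_pair_num h ψ pullFrac₂ hpull hii h3 h4b h8 h15a h15 (Classical.choose (hii f P))
    (Classical.choose_spec (hii f P)).1 (Classical.choose_spec (hii f P)).2

/-- `s″_N` of the transported root: `Ψ s″_N`. [cite: MochizukiEtTh2009, Thm 4.4 (ii) p.320 (PDF p.94)] -/
theorem transport_pair_den :
    (R.transport h ψ pullFrac₂ hpull hii h3 h4b h8 h15a h15 eA eB P₂ hnum hden hf heA heB hArises hpull₂).pair.den =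
      h.Ψ.functor.map R.pair.den :=
  R.map_pair_den h ψ pullFrac₂ hpull hii h3 h4b h8 h15a h15 (Classical.choose (hii f P))
    (Classical.choose_spec (hii f P)).1 (Classical.choose_spec (hii f P)).2

/-- `α′` of the transported root: `Ψ α′ ≫ eA` — so `f|_{Ψ A_N} = ((Ψ α′ ≫ eA)^birat)^* f₂ = ψ (f|_{A_N})`.
[cite: MochizukiEtTh2009, Prop 4.2 (iii) p.314 (PDF p.88)] -/
theorem transport_αData_α₁ :
    (R.transport h ψ pullFrac₂ hpull hii h3 h4b h8 h15a h15 eA eB P₂ hnum hden hf heA heB hArises hpull₂).αData.α₁ =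
      h.Ψ.functor.map R.αData.α₁ ≫ eA.hom := by
  show (Classical.choose (h4b R.α R.αData)).α₁ ≫ eA.hom = _
  rw [(Classical.choose_spec (h4b R.α R.αData)).2.2]

end transport

end NthRoot

end BiKummerSetting

end Literature.AnabelianGeometry.EtaleTheta

end
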